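import Mathlib.Analysis.MeanInequalitiesPow
import Literature.MathematicalPhysics.KineticTheory.HardSphereEuler

/-!
# Macroscopic bookkeeping for the hydrodynamic-limit assembly — VII: hot blocks

Helper file for item stmt-AtomisticToContinuum-11094 (`StiffCollisionalRelaxation.Assembly`).
`RelEntropyStability` asks for the hot-cell functional
`∫₀^{t₁}∫ₓ 1{M ρ̄ < Ē} (Ē^{3/2} ρ̄^{-1/2} + Ē + ρ̄) ≤ C e^{-λM}` of the comparison field; the assembly
must produce it from the time-integrated one-particle exponential velocity moment of
`AprioriBounds (i)`. This file proves the POINTWISE (one block, one configuration) core, a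
Chebyshev argument in the block measure `χ(q) dμ_z` with `χ ≥ 0` (the kernel translate
`φ_N(· − x)`):

* `le_mul_exp_of_le` — `y ≤ K e^{-λK} e^{λy}` for `y ≥ K ≥ λ⁻¹` (from `1 + x ≤ eˣ`);
* `blockEnergy_le` — `Ē ≤ (K/2) ρ̄ + (K/2) e^{-λK} F` with `F = ⟨μ_z, χ e^{λ‖v‖²}⟩`, `K ≥ λ⁻¹`;
* `hotBlock_density_lt`, `hotBlock_energy_lt` — on a hot block (`M ρ̄ < Ē`, `M ≥ λ⁻¹`):
  `ρ̄ < e^{-λM} F` and `Ē < M e^{-λM} F`;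
* `blockEnergy_pow_three_le` — power mean: `Ē³ ≤ ρ̄² ⟨μ_z, χ (‖v‖²/2)³⟩`;
* `cube_half_le_exp` — `(a/2)³ ≤ (3/(4λ³)) e^{λa}` for `a ≥ 0`;
* `hotBlock_functional_le` — the hot-cell integrand is at most
  `(√(3/(4λ³)) + 2/λ + 1) e^{-λM/2} F`.
-/

namespace Summit.AtomisticToContinuum.HydrodynamicLimit.Theorems.MacroBookkeeping

open MeasureTheory Finset
open Literature.MathematicalPhysics.KineticTheory
open Literature.Analysis.FluidPDE (Config empiricalMeasure integral_empiricalMeasure)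

noncomputable section

/-! ### Scalar inequalities -/

/-- `y ≤ K e^{-λK} e^{λy}` for `y ≥ K ≥ λ⁻¹` (the function `y e^{-λy}` decreases past `λ⁻¹`;
elementary proof from `1 + x ≤ eˣ`). -/
theorem le_mul_exp_of_le {lam K y : ℝ} (hlam : 0 < lam) (hK : lam⁻¹ ≤ K) (hy : K ≤ y) :
    y ≤ K * Real.exp (-(lam * K)) * Real.exp (lam * y) := by
  have hKpos : 0 < K := (inv_pos.2 hlam).trans_le hK
  have hlamK : 1 ≤ lam * K := by
    have := mul_le_mul_of_nonneg_left hK hlam.le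
    rwa [mul_inv_cancel₀ hlam.ne'] at this
  have h1 : y / K ≤ Real.exp (lam * (y - K)) := by
    have h2 : y / K ≤ lam * (y - K) + 1 := by
      rw [div_le_iff₀ hKpos]
      nlinarith
    exact h2.trans (Real.add_one_le_exp _)
  have h3 : Real.exp (lam * (y - K)) = Real.exp (-(lam * K)) * Real.exp (lam * y) := by
    rw [← Real.exp_add]
    congr 1
    ring
  calc y = K * (y / K) := by field_simp
    _ ≤ K * Real.exp (lam * (y - K)) := mul_le_mul_of_nonneg_left h1 hKpos.le
    _ = K * Real.exp (-(lam * K)) * Real.exp (lam * y) := by rw [h3, mul_assoc]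

/-- Per-particle energy bound: `a/2 ≤ K/2 + (K/2) e^{-λK} e^{λa}` for `K ≥ λ⁻¹`. -/
theorem half_le_of_exp {lam K : ℝ} (hlam : 0 < lam) (hK : lam⁻¹ ≤ K) (a : ℝ) :
    a / 2 ≤ K / 2 + K / 2 * Real.exp (-(lam * K)) * Real.exp (lam * a) := by
  have hKpos : 0 < K := (inv_pos.2 hlam).trans_le hK
  have hnn : 0 ≤ K / 2 * Real.exp (-(lam * K)) * Real.exp (lam * a) := by positivity
  by_cases haK : a < K
  · linarith
  · have h := le_mul_exp_of_le hlam hK (le_of_not_gt haK)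
    nlinarith

/-- `(a/2)³ ≤ (3/(4λ³)) e^{λa}` for `a ≥ 0` (from `x³/3! ≤ eˣ`). -/
theorem cube_half_le_exp {lam a : ℝ} (hlam : 0 < lam) (ha : 0 ≤ a) :
    (a / 2) ^ 3 ≤ 3 / (4 * lam ^ 3) * Real.exp (lam * a) := by
  have h := Real.pow_div_factorial_le_exp (lam * a) (mul_nonneg hlam.le ha) 3
  have h3 : ((Nat.factorial 3 : ℕ) : ℝ) = 6 := by norm_num [Nat.factorial]
  rw [h3, mul_pow, div_le_iff₀ (by norm_num : (0 : ℝ) < 6)] at h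
  have hl3 : 0 < lam ^ 3 := by positivity
  have h4 : (a / 2) ^ 3 = (lam ^ 3 * a ^ 3) / (8 * lam ^ 3) := by
    field_simp
    norm_num
  have h5 : 3 / (4 * lam ^ 3) * Real.exp (lam * a) = (6 * Real.exp (lam * a)) / (8 * lam ^ 3) := by
    field_simp
    ring
  rw [h4, h5]
  exact div_le_div_of_nonneg_right (by linarith) (by positivity)

/-- `M e^{-λM} ≤ (2/λ) e^{-λM/2}` (since `x e^{-x} ≤ 1`). -/
theorem mul_exp_neg_le {lam : ℝ} (hlam : 0 < lam) (M : ℝ) :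
    M * Real.exp (-(lam * M)) ≤ 2 / lam * Real.exp (-(lam * M / 2)) := by
  have hx : lam * M / 2 ≤ Real.exp (lam * M / 2) :=
    (by linarith : lam * M / 2 ≤ lam * M / 2 + 1).trans (Real.add_one_le_exp _)
  have hsplit : Real.exp (-(lam * M)) = Real.exp (-(lam * M / 2)) * Real.exp (-(lam * M / 2)) := by
    rw [← Real.exp_add]
    congr 1
    ring
  have hE : 0 < Real.exp (-(lam * M / 2)) := Real.exp_pos _
  have hinv : Real.exp (-(lam * M / 2)) * Real.exp (lam * M / 2) = 1 := by
    rw [← Real.exp_add, neg_add_cancel, Real.exp_zero]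
  rw [hsplit, ← mul_assoc]
  refine mul_le_mul_of_nonneg_right ?_ hE.le
  -- `M e^{-λM/2} ≤ 2/λ`
  have key : lam * M / 2 * Real.exp (-(lam * M / 2)) ≤ 1 := by
    calc lam * M / 2 * Real.exp (-(lam * M / 2))
        ≤ Real.exp (lam * M / 2) * Real.exp (-(lam * M / 2)) :=
          mul_le_mul_of_nonneg_right hx hE.le
      _ = 1 := by rw [mul_comm, hinv]
  have h1 : M * Real.exp (-(lam * M / 2)) = 2 / lam * (lam * M / 2 * Real.exp (-(lam * M / 2))) := by
    field_simp
  rw [h1]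
  exact mul_le_of_le_one_right (by positivity) key

/-! ### One block of one configuration -/

section Block

variable {N : ℕ} (z : Config N (Fin 3) T3) {χ : T3 → ℝ} (hχ : ∀ y, 0 ≤ χ y) {lam : ℝ}
  (hlam : 0 < lam)

/-- The exponential velocity moment of the block: `F = ⟨μ_z, χ(q) e^{λ‖v‖²}⟩`. -/
def blockExpMoment (lam : ℝ) (z : Config N (Fin 3) T3) (χ : T3 → ℝ) : ℝ :=
  ∫ y, χ y.1 * Real.exp (lam * ‖y.2‖ ^ 2) ∂empiricalMeasure z

/-- The block fields and the exponential moment as finite sums. -/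
theorem block_sums (lam : ℝ) :
    empiricalDensityField z χ = (N : ℝ)⁻¹ * ∑ i, χ (z i).1 ∧
    empiricalEnergyField z χ = (N : ℝ)⁻¹ * ∑ i, χ (z i).1 * (‖(z i).2‖ ^ 2 / 2) ∧
    blockExpMoment lam z χ = (N : ℝ)⁻¹ * ∑ i, χ (z i).1 * Real.exp (lam * ‖(z i).2‖ ^ 2) :=
  ⟨integral_empiricalMeasure z _, integral_empiricalMeasure z _, integral_empiricalMeasure z _⟩

include hχ in
/-- Nonnegativity of the block density. -/
theorem blockDensity_nonneg : 0 ≤ empiricalDensityField z χ := by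
  rw [(block_sums z 0).1]
  exact mul_nonneg (by positivity) (Finset.sum_nonneg fun i _ => hχ _)

include hχ in
/-- Nonnegativity of the block energy. -/
theorem blockEnergy_nonneg : 0 ≤ empiricalEnergyField z χ := by
  rw [(block_sums z 0).2.1]
  exact mul_nonneg (by positivity) (Finset.sum_nonneg fun i _ => mul_nonneg (hχ _) (by positivity))

include hχ in
/-- Nonnegativity of the exponential moment. -/
theorem blockExpMoment_nonneg : 0 ≤ blockExpMoment lam z χ := by
  rw [(block_sums z lam).2.2]
  exact mul_nonneg (by positivity)
    (Finset.sum_nonneg fun i _ => mul_nonneg (hχ _) (Real.exp_pos _).le)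

include hχ hlam in
/-- **Energy against the exponential moment**: `Ē ≤ (K/2) ρ̄ + (K/2) e^{-λK} F`, `K ≥ λ⁻¹`. -/
theorem blockEnergy_le {K : ℝ} (hK : lam⁻¹ ≤ K) :
    empiricalEnergyField z χ ≤ K / 2 * empiricalDensityField z χ +
      K / 2 * Real.exp (-(lam * K)) * blockExpMoment lam z χ := by
  obtain ⟨hρ, hE, hF⟩ := block_sums z lam (χ := χ)
  rw [hρ, hE, hF]
  have hpt : ∀ i, χ (z i).1 * (‖(z i).2‖ ^ 2 / 2) ≤ K / 2 * χ (z i).1 +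
      K / 2 * Real.exp (-(lam * K)) * (χ (z i).1 * Real.exp (lam * ‖(z i).2‖ ^ 2)) := by
    intro i
    have h := half_le_of_exp hlam hK (‖(z i).2‖ ^ 2)
    have hc := hχ (z i).1
    calc χ (z i).1 * (‖(z i).2‖ ^ 2 / 2)
        ≤ χ (z i).1 * (K / 2 + K / 2 * Real.exp (-(lam * K)) * Real.exp (lam * ‖(z i).2‖ ^ 2)) :=
          mul_le_mul_of_nonneg_left h hc
      _ = K / 2 * χ (z i).1 +
          K / 2 * Real.exp (-(lam * K)) * (χ (z i).1 * Real.exp (lam * ‖(z i).2‖ ^ 2)) := by ring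
  calc (N : ℝ)⁻¹ * ∑ i, χ (z i).1 * (‖(z i).2‖ ^ 2 / 2)
      ≤ (N : ℝ)⁻¹ * ∑ i, (K / 2 * χ (z i).1 +
          K / 2 * Real.exp (-(lam * K)) * (χ (z i).1 * Real.exp (lam * ‖(z i).2‖ ^ 2))) :=
        mul_le_mul_of_nonneg_left (Finset.sum_le_sum fun i _ => hpt i) (by positivity)
    _ = K / 2 * ((N : ℝ)⁻¹ * ∑ i, χ (z i).1) +
        K / 2 * Real.exp (-(lam * K)) *
          ((N : ℝ)⁻¹ * ∑ i, χ (z i).1 * Real.exp (lam * ‖(z i).2‖ ^ 2)) := by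
        rw [Finset.sum_add_distrib, ← Finset.mul_sum, ← Finset.mul_sum]
        ring

include hχ hlam in
/-- **Hot block, density**: `M ρ̄ < Ē` with `M ≥ λ⁻¹` forces `ρ̄ < e^{-λM} F`. -/
theorem hotBlock_density_lt {M : ℝ} (hM : lam⁻¹ ≤ M)
    (hhot : M * empiricalDensityField z χ < empiricalEnergyField z χ) :
    empiricalDensityField z χ < Real.exp (-(lam * M)) * blockExpMoment lam z χ := by
  have hMpos : 0 < M := (inv_pos.2 hlam).trans_le hM
  have h := blockEnergy_le z hχ hlam hM
  nlinarith

include hχ hlam in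
/-- **Hot block, energy**: `M ρ̄ < Ē` with `M ≥ λ⁻¹` forces `Ē < M e^{-λM} F`. -/
theorem hotBlock_energy_lt {M : ℝ} (hM : lam⁻¹ ≤ M)
    (hhot : M * empiricalDensityField z χ < empiricalEnergyField z χ) :
    empiricalEnergyField z χ < M * Real.exp (-(lam * M)) * blockExpMoment lam z χ := by
  have hMpos : 0 < M := (inv_pos.2 hlam).trans_le hM
  have h := blockEnergy_le z hχ hlam hM
  have hρ := hotBlock_density_lt z hχ hlam hM hhot
  nlinarith [Real.exp_pos (-(lam * M)), blockExpMoment_nonneg z hχ (lam := lam)]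

include hχ in
/-- **Power mean**: `Ē³ ≤ ρ̄² ⟨μ_z, χ (‖v‖²/2)³⟩`. -/
theorem blockEnergy_pow_three_le :
    empiricalEnergyField z χ ^ 3 ≤ empiricalDensityField z χ ^ 2 *
      ∫ y, χ y.1 * (‖y.2‖ ^ 2 / 2) ^ 3 ∂empiricalMeasure z := by
  obtain ⟨hρ, hE, -⟩ := block_sums z (0 : ℝ) (χ := χ)
  rw [hρ, hE, integral_empiricalMeasure]
  set R := (N : ℝ)⁻¹ * ∑ i, χ (z i).1 with hR
  have hRnn : 0 ≤ R := mul_nonneg (by positivity) (Finset.sum_nonneg fun i _ => hχ _)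
  rcases hRnn.eq_or_lt with hR0 | hRpos
  · -- all weights vanish: both sides are zero
    have hw : ∀ i, (N : ℝ)⁻¹ * χ (z i).1 = 0 := by
      intro i
      by_cases hN : N = 0
      · subst hN; exact Fin.elim0 i
      have hterm : ∀ j ∈ (univ : Finset (Fin N)), 0 ≤ (N : ℝ)⁻¹ * χ (z j).1 := fun j _ =>
        mul_nonneg (by positivity) (hχ _)
      have hsum : ∑ j, (N : ℝ)⁻¹ * χ (z j).1 = 0 := by rw [← Finset.mul_sum]; exact hR0.symm
      exact (Finset.sum_eq_zero_iff_of_nonneg hterm).1 hsum i (mem_univ i)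
    have hE0 : (N : ℝ)⁻¹ * ∑ i, χ (z i).1 * (‖(z i).2‖ ^ 2 / 2) = 0 := by
      rw [Finset.mul_sum]
      exact Finset.sum_eq_zero fun i _ => by rw [← mul_assoc, hw i, zero_mul]
    rw [hE0, ← hR0]
    simp
  · -- Jensen for the probability weights `N⁻¹ χᵢ / R`
    have hw : ∀ i ∈ (univ : Finset (Fin N)), 0 ≤ (N : ℝ)⁻¹ * χ (z i).1 / R := fun i _ =>
      div_nonneg (mul_nonneg (by positivity) (hχ _)) hRpos.le
    have hw1 : ∑ i, (N : ℝ)⁻¹ * χ (z i).1 / R = 1 := by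
      rw [← Finset.sum_div, ← Finset.mul_sum, div_self hRpos.ne']
    have hz : ∀ i ∈ (univ : Finset (Fin N)), 0 ≤ ‖(z i).2‖ ^ 2 / 2 := fun i _ => by positivity
    have hJ := Real.pow_arith_mean_le_arith_mean_pow univ _ _ hw hw1 hz 3
    have hlhs : ∑ i, (N : ℝ)⁻¹ * χ (z i).1 / R * (‖(z i).2‖ ^ 2 / 2) =
        ((N : ℝ)⁻¹ * ∑ i, χ (z i).1 * (‖(z i).2‖ ^ 2 / 2)) / R := by
      rw [Finset.mul_sum, Finset.sum_div]
      exact Finset.sum_congr rfl fun i _ => by ring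
    have hrhs : ∑ i, (N : ℝ)⁻¹ * χ (z i).1 / R * (‖(z i).2‖ ^ 2 / 2) ^ 3 =
        ((N : ℝ)⁻¹ * ∑ i, χ (z i).1 * (‖(z i).2‖ ^ 2 / 2) ^ 3) / R := by
      rw [Finset.mul_sum, Finset.sum_div]
      exact Finset.sum_congr rfl fun i _ => by ring
    rw [hlhs, hrhs, div_pow, div_le_div_iff₀ (pow_pos hRpos 3) hRpos] at hJ
    have hR3 : R ^ 3 = R * R ^ 2 := by ring
    rw [hR3] at hJ
    have := le_of_mul_le_mul_left (by linarith [hJ] :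
      R * (((N : ℝ)⁻¹ * ∑ i, χ (z i).1 * (‖(z i).2‖ ^ 2 / 2)) ^ 3) ≤
        R * (R ^ 2 * ((N : ℝ)⁻¹ * ∑ i, χ (z i).1 * (‖(z i).2‖ ^ 2 / 2) ^ 3))) hRpos
    linarith

include hχ hlam in
/-- The cubic moment against the exponential one: `⟨μ_z, χ (‖v‖²/2)³⟩ ≤ (3/(4λ³)) F`. -/
theorem blockCube_le :
    ∫ y, χ y.1 * (‖y.2‖ ^ 2 / 2) ^ 3 ∂empiricalMeasure z ≤
      3 / (4 * lam ^ 3) * blockExpMoment lam z χ := by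
  rw [integral_empiricalMeasure z (fun y => χ y.1 * (‖y.2‖ ^ 2 / 2) ^ 3),
    (block_sums z lam (χ := χ)).2.2]
  have hpt : ∀ i, χ (z i).1 * (‖(z i).2‖ ^ 2 / 2) ^ 3 ≤
      3 / (4 * lam ^ 3) * (χ (z i).1 * Real.exp (lam * ‖(z i).2‖ ^ 2)) := by
    intro i
    have h := cube_half_le_exp hlam (sq_nonneg ‖(z i).2‖)
    calc χ (z i).1 * (‖(z i).2‖ ^ 2 / 2) ^ 3 ≤ χ (z i).1 * (3 / (4 * lam ^ 3) *
        Real.exp (lam * ‖(z i).2‖ ^ 2)) := mul_le_mul_of_nonneg_left h (hχ _)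
      _ = 3 / (4 * lam ^ 3) * (χ (z i).1 * Real.exp (lam * ‖(z i).2‖ ^ 2)) := by ring
  calc (N : ℝ)⁻¹ * ∑ i, χ (z i).1 * (‖(z i).2‖ ^ 2 / 2) ^ 3
      ≤ (N : ℝ)⁻¹ * ∑ i, 3 / (4 * lam ^ 3) * (χ (z i).1 * Real.exp (lam * ‖(z i).2‖ ^ 2)) :=
        mul_le_mul_of_nonneg_left (Finset.sum_le_sum fun i _ => hpt i) (by positivity)
    _ = 3 / (4 * lam ^ 3) * ((N : ℝ)⁻¹ * ∑ i, χ (z i).1 * Real.exp (lam * ‖(z i).2‖ ^ 2)) := by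
        rw [← Finset.mul_sum]
        ring

include hχ hlam in
/-- **The hot-cell integrand on a hot block**: with `M ≥ λ⁻¹` and `M ρ̄ < Ē`,
`Ē^{3/2}/√ρ̄ + Ē + ρ̄ ≤ (√(3/(4λ³)) + 2/λ + 1) e^{-λM/2} F`. -/
theorem hotBlock_functional_le {M : ℝ} (hM : lam⁻¹ ≤ M)
    (hhot : M * empiricalDensityField z χ < empiricalEnergyField z χ) :
    empiricalEnergyField z χ ^ (3 / 2 : ℝ) / Real.sqrt (empiricalDensityField z χ) +
      empiricalEnergyField z χ + empiricalDensityField z χ ≤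
      (Real.sqrt (3 / (4 * lam ^ 3)) + 2 / lam + 1) * Real.exp (-(lam * M / 2)) *
        blockExpMoment lam z χ := by
  have hMpos : 0 < M := (inv_pos.2 hlam).trans_le hM
  set ρb := empiricalDensityField z χ with hρb
  set Eb := empiricalEnergyField z χ with hEb
  set F := blockExpMoment lam z χ with hFdef
  have hρnn : 0 ≤ ρb := blockDensity_nonneg z hχ
  have hEnn : 0 ≤ Eb := blockEnergy_nonneg z hχ
  have hFnn : 0 ≤ F := blockExpMoment_nonneg z hχ (lam := lam)
  have hρlt := hotBlock_density_lt z hχ hlam hM hhot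
  have hElt := hotBlock_energy_lt z hχ hlam hM hhot
  have hcube := (blockEnergy_pow_three_le z hχ).trans
    (mul_le_mul_of_nonneg_left (blockCube_le z hχ hlam) (sq_nonneg _))
  set c := 3 / (4 * lam ^ 3) with hc
  have hcpos : 0 < c := by positivity
  have hhalf : Real.exp (-(lam * M)) = Real.exp (-(lam * M / 2)) ^ 2 := by
    rw [sq, ← Real.exp_add]
    congr 1
    ring
  have hexp_le : Real.exp (-(lam * M)) ≤ Real.exp (-(lam * M / 2)) :=
    Real.exp_le_exp.2 (by nlinarith)
  -- the `3/2`-power term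
  have hpow : Eb ^ (3 / 2 : ℝ) / Real.sqrt ρb ≤ Real.sqrt c * Real.exp (-(lam * M / 2)) * F := by
    rcases hρnn.eq_or_lt with hρ0 | hρpos
    · rw [← hρ0, Real.sqrt_zero, div_zero]
      positivity
    have h1 : Eb ^ (3 / 2 : ℝ) = Real.sqrt (Eb ^ 3) := by
      rw [Real.sqrt_eq_rpow, ← Real.rpow_natCast, ← Real.rpow_mul hEnn]
      norm_num
    have h2 : Eb ^ (3 / 2 : ℝ) / Real.sqrt ρb = Real.sqrt (Eb ^ 3 / ρb) := by
      rw [h1, Real.sqrt_div' _ hρnn]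
    have h3 : Eb ^ 3 / ρb ≤ ρb * (c * F) := by
      rw [div_le_iff₀ hρpos]
      calc Eb ^ 3 ≤ ρb ^ 2 * (c * F) := hcube
        _ = ρb * (c * F) * ρb := by ring
    have h4 : ρb * (c * F) ≤ (Real.exp (-(lam * M / 2)) * Real.sqrt c * F) ^ 2 := by
      calc ρb * (c * F) ≤ Real.exp (-(lam * M)) * F * (c * F) :=
            mul_le_mul_of_nonneg_right hρlt.le (by positivity)
        _ = (Real.exp (-(lam * M / 2)) * Real.sqrt c * F) ^ 2 := by
            rw [hhalf, mul_pow, mul_pow, Real.sq_sqrt hcpos.le]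
            ring
    rw [h2]
    calc Real.sqrt (Eb ^ 3 / ρb) ≤ Real.sqrt ((Real.exp (-(lam * M / 2)) * Real.sqrt c * F) ^ 2) :=
          Real.sqrt_le_sqrt (h3.trans h4)
      _ = Real.exp (-(lam * M / 2)) * Real.sqrt c * F := Real.sqrt_sq (by positivity)
      _ = Real.sqrt c * Real.exp (-(lam * M / 2)) * F := by ring
  -- the linear terms
  have hlin : Eb + ρb ≤ (2 / lam + 1) * Real.exp (-(lam * M / 2)) * F := by
    have h5 : Eb ≤ 2 / lam * Real.exp (-(lam * M / 2)) * F := by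
      refine hElt.le.trans ?_
      exact mul_le_mul_of_nonneg_right (mul_exp_neg_le hlam M) hFnn
    have h6 : ρb ≤ Real.exp (-(lam * M / 2)) * F :=
      hρlt.le.trans (mul_le_mul_of_nonneg_right hexp_le hFnn)
    nlinarith
  calc Eb ^ (3 / 2 : ℝ) / Real.sqrt ρb + Eb + ρb
      ≤ Real.sqrt c * Real.exp (-(lam * M / 2)) * F + (2 / lam + 1) * Real.exp (-(lam * M / 2)) * F := by
        linarith
    _ = (Real.sqrt c + 2 / lam + 1) * Real.exp (-(lam * M / 2)) * F := by ring

end Block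

end

end Summit.AtomisticToContinuum.HydrodynamicLimit.Theorems.MacroBookkeeping
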